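import Summits.AtomisticToContinuum.Crystallization.Theorems.ChartedZeroExcessLayeredLatticeLiouvilleZZZYRD
import Literature.Geometry.DiscreteGeometry.LayerShells

/-!
# ChartedZeroExcess · LayeredLatticeLiouville ZZZYRDR (lens-2 g98 «EK-REG» — the REGULAR-CELL K-UNIT beneath NODE E's crux (CC♯)) — docket 26636

TARGET (tree ZZZYRD, (239)): (CC♯) `CellCertificateP s Λ c₀ ℓ₀ r₁ c` asks, for every admissible word, ONE multiplier `μ` making every tet
certificate `tetCert c μ = (c·S_t − N_t)/6 − μ·vol_t σ₂(G_t)` and every oct certificate `octCert c μ = (c·S_o − N_o)/3 − μ·Σ_{4 sub-tets} vol σ₂(G)`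
non-negative for every field.  THIS FILE decides the SPECIAL (regular) case at the level of the OBJECTS `tetCert` / `octCert` (critic r1763 (5)):
at the reference regular tetrahedron `refTet = (0,0,0),(1,1,0),(1,0,1),(0,1,1)` and the reference regular octahedron `refOct = (±1,0,0),(0,±1,0),(0,0,±1)`
of the INTEGER fcc frame (edge `√2`, all matrices rational), with `c = 8` and `μ = −4` (file sign convention; `= −4√2/ℓ` at edge `ℓ` by the degree-1
scaling of the null-Lagrangian term), the certificates are EXPLICIT SUMS OF SQUARES with positive rational weights:
  tet (12 variables, rank 4):  weights `1/30, 1/270, 1/702, 2/13`;   oct (18 variables, rank 10, diagonal split `(0,1)`):  weights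
  `1/4, 1/12, 1/12, 1/4, 1/12, 1/12, 1/6, 1/2, 1/42, 2/7`
(desk EXACT-98 / SOS-98: exact `LDLᵀ` in `ℚ`, kernels `8 = 3 translations + 3 rotations + 2 tight modes` — `c = 8` is TIGHT: `c = 8 − 10⁻³` is
infeasible for every `μ`).  Hence `0 ≤ tetCert 8 (−4) a b w φ t` / `0 ≤ octCert 8 (−4) a b w φ o` for every word `(a, b, w)`, every field `φ` and every
labelled cell whose positions ARE the reference cells (`tetCert_nonneg_of_cellPos`, `octCert_nonneg_of_cellPos`).  The Lean route: coordinates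
(`pairN_coord`, `pairS_coord`; coordinates of `⟪·,·⟫`/`‖·‖²` = TREE Literature `LayerShells.inner_fin3`/`norm_sq_fin3`, lane ed1), the edge matrices / inverses / volumes of the five reference simplices by `fin_cases`,
`σ₂` written out (`sigmaTwo_fin_three`), the pair sums written out (`sum_tetPairs`, `sum_octPairs`), then `positivity` on the SOS and ONE `ring`
identity each (no search); no options, no `native_decide`.
NOT HERE (M-class bridge, next unit «EK-SIM»): similarity covariance `cert(c, μ; s·Q·P + v, Q·Φ) = cert(c, μ·s; P, Φ)` and relabelling invariance,
which carry these two theorems to every regular cell of every unstrained Barlow word (the regular-word case of (CC♯) with `c = 8`); the strained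
box (c_cell = 10 on the CELLBOX B of memo §10) is the interval K-file of record.
Desk replication: `g98/desk/exact98.py` (7d749f07b1e87c84), `g98/desk/sos98.py` (prints exactly the squares below and checks `M = Σ d_k ℓ_k ℓ_kᵀ` in ℚ).
-/

open scoped BigOperators InnerProductSpace RealInnerProductSpace

namespace Summit.AtomisticToContinuum.Crystallization.Theorems.ChartedZeroExcessLayeredLatticeLiouville

open Literature.Geometry.DiscreteGeometry (inner_fin3 norm_sq_fin3)

open Summit.AtomisticToContinuum.Crystallization.Theorems.ChartedPlanarOrderRigidityDoor (E3)

/-! ### Coordinates -/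

/-- reference regular TETRAHEDRON in the integer fcc frame (edge `√2`, volume `1/3`). [g98] -/
def refTet : Fin 4 → E3 := ![!₂[0, 0, 0], !₂[1, 1, 0], !₂[1, 0, 1], !₂[0, 1, 1]]


/-- edge matrix of the reference tetrahedron. -/
theorem edgeMat_refTet : edgeMat refTet = !![1, 1, 0; 1, 0, 1; 0, 1, 1] := by
  ext i j; fin_cases i <;> fin_cases j <;> simp [edgeMat, refTet]

/-- the displacement term in coordinates. -/
theorem pairN_coord {k : ℕ} (Φ : Fin k → E3) (p : Fin k × Fin k) :
    pairN Φ p = (Φ p.2 0 - Φ p.1 0) ^ 2 + (Φ p.2 1 - Φ p.1 1) ^ 2 + (Φ p.2 2 - Φ p.1 2) ^ 2 := by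
  unfold pairN
  rw [EuclideanSpace.norm_eq, Real.sq_sqrt (Finset.sum_nonneg fun i _ => by positivity), Fin.sum_univ_three]
  simp [Real.norm_eq_abs, sq_abs]

/-- the edge matrix of a field on a labelled tetrahedron in coordinates. -/
theorem edgeMat_coord (Φ : Fin 4 → E3) :
    edgeMat Φ = !![Φ 1 0 - Φ 0 0, Φ 2 0 - Φ 0 0, Φ 3 0 - Φ 0 0;
                   Φ 1 1 - Φ 0 1, Φ 2 1 - Φ 0 1, Φ 3 1 - Φ 0 1;
                   Φ 1 2 - Φ 0 2, Φ 2 2 - Φ 0 2, Φ 3 2 - Φ 0 2] := by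
  ext i j; fin_cases i <;> fin_cases j <;> simp [edgeMat]

/-- inverse edge matrix of the reference tetrahedron (rational). -/
theorem edgeMat_refTet_inv : (edgeMat refTet)⁻¹ = !![1/2, 1/2, -1/2; 1/2, -1/2, 1/2; -1/2, 1/2, 1/2] := by
  rw [edgeMat_refTet]
  apply Matrix.inv_eq_right_inv
  ext i j; fin_cases i <;> fin_cases j <;>
    norm_num [Matrix.mul_apply, Fin.sum_univ_three, Matrix.cons_val_zero, Matrix.cons_val_one, Matrix.cons_val_two,
      Matrix.head_cons, Matrix.tail_cons]

/-- volume of the reference tetrahedron. -/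
theorem simplexVol_refTet : simplexVol refTet = 1 / 3 := by
  rw [simplexVol, edgeMat_refTet, Matrix.det_fin_three]
  norm_num [Matrix.cons_val_zero, Matrix.cons_val_one, Matrix.cons_val_two, Matrix.head_cons, Matrix.tail_cons]


/-- the stretch term in coordinates. -/
theorem pairS_coord {k : ℕ} (P Φ : Fin k → E3) (p : Fin k × Fin k) :
    pairS P Φ p = ((P p.2 0 - P p.1 0) * (Φ p.2 0 - Φ p.1 0) + (P p.2 1 - P p.1 1) * (Φ p.2 1 - Φ p.1 1) +
        (P p.2 2 - P p.1 2) * (Φ p.2 2 - Φ p.1 2)) ^ 2 / ((P p.2 0 - P p.1 0) ^ 2 + (P p.2 1 - P p.1 1) ^ 2 + (P p.2 2 - P p.1 2) ^ 2) := by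
  unfold pairS
  rw [inner_fin3, norm_sq_fin3]
  simp only [PiLp.sub_apply]

/-- `σ₂` of a `3×3` matrix written out (sum of the three principal `2×2` minors). -/
theorem sigmaTwo_fin_three (G : Matrix (Fin 3) (Fin 3) ℝ) :
    sigmaTwo G = G 0 0 * G 1 1 - G 0 1 * G 1 0 + (G 0 0 * G 2 2 - G 0 2 * G 2 0) + (G 1 1 * G 2 2 - G 1 2 * G 2 1) := by
  unfold sigmaTwo
  rw [Matrix.trace_fin_three, Matrix.trace_fin_three]
  simp only [Matrix.mul_apply, Fin.sum_univ_three]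
  ring

/-- the six-pair sum written out. -/
theorem sum_tetPairs (f : Fin 4 × Fin 4 → ℝ) :
    ∑ p ∈ tetPairs, f p = f (0, 1) + f (0, 2) + f (0, 3) + f (1, 2) + f (1, 3) + f (2, 3) := by
  simp only [tetPairs, Finset.sum_filter, Fintype.sum_prod_type, Fin.sum_univ_four]
  simp [Fin.lt_def]
  ring

/-- ★ the REGULAR TET CERTIFICATE at `c = 8`, `μ = −4` (file convention), reference cell in the integer fcc frame: an explicit four-square SOS. -/
theorem tetCertRef_nonneg (Φ : Fin 4 → E3) :
    0 ≤ (8 * ∑ p ∈ tetPairs, pairS refTet Φ p - ∑ p ∈ tetPairs, pairN Φ p) / 6 - (-4) * simplexNL refTet Φ := by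
  rw [sum_tetPairs, sum_tetPairs]
  rw [simplexNL, simplexVol_refTet, affGrad, edgeMat_refTet_inv, edgeMat_coord, Matrix.mul_fin_three, sigmaTwo_fin_three]
  simp only [Matrix.of_apply, Matrix.cons_val', Matrix.cons_val_zero, Matrix.cons_val_one, Matrix.cons_val_two, Matrix.head_cons,
    Matrix.tail_cons, Matrix.empty_val', Matrix.cons_val_fin_one]
  simp only [pairS_coord, pairN_coord]
  simp only [refTet, Matrix.cons_val_zero, Matrix.cons_val_one, Matrix.cons_val_two, Matrix.head_cons, Matrix.tail_cons,
    Matrix.cons_val_three]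
  norm_num
  have h : (0 : ℝ) ≤ (1/30 : ℝ) * ((5 : ℝ) * Φ 0 0 + (4 : ℝ) * Φ 0 1 + (4 : ℝ) * Φ 0 2 + (-3 : ℝ) * Φ 1 0 + (-4 : ℝ) * Φ 1 1 + (2 : ℝ) * Φ 1 2 +
      (-3 : ℝ) * Φ 2 0 + (2 : ℝ) * Φ 2 1 + (-4 : ℝ) * Φ 2 2 + (1 : ℝ) * Φ 3 0 + (-2 : ℝ) * Φ 3 1 + (-2 : ℝ) * Φ 3 2) ^ 2 +
      (1/270 : ℝ) * ((9 : ℝ) * Φ 0 1 + (4 : ℝ) * Φ 0 2 + (-8 : ℝ) * Φ 1 0 + (1 : ℝ) * Φ 1 1 + (2 : ℝ) * Φ 1 2 + (2 : ℝ) * Φ 2 0 + (-3 : ℝ) * Φ 2 1 +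
          (6 : ℝ) * Φ 2 2 + (6 : ℝ) * Φ 3 0 + (-7 : ℝ) * Φ 3 1 + (-12 : ℝ) * Φ 3 2) ^ 2 +
      (1/702 : ℝ) * ((13 : ℝ) * Φ 0 2 + (10 : ℝ) * Φ 1 0 + (10 : ℝ) * Φ 1 1 + (-7 : ℝ) * Φ 1 2 + (-16 : ℝ) * Φ 2 0 + (6 : ℝ) * Φ 2 1 + (-3 : ℝ) * Φ 2 2 +
          (6 : ℝ) * Φ 3 0 + (-16 : ℝ) * Φ 3 1 + (-3 : ℝ) * Φ 3 2) ^ 2 +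
      (2/13 : ℝ) * ((1 : ℝ) * Φ 1 0 + (1 : ℝ) * Φ 1 1 + (-2 : ℝ) * Φ 1 2 + (1 : ℝ) * Φ 2 0 + (-2 : ℝ) * Φ 2 1 + (1 : ℝ) * Φ 2 2 + (-2 : ℝ) * Φ 3 0 +
          (1 : ℝ) * Φ 3 1 + (1 : ℝ) * Φ 3 2) ^ 2 := by positivity
  exact h.trans_eq (by ring)


/-- reference regular OCTAHEDRON in the integer fcc frame (edge `√2`), labelled with antipodes `(0,1), (2,3), (4,5)`. -/
def refOct : Fin 6 → E3 := ![!₂[1, 0, 0], !₂[-1, 0, 0], !₂[0, 1, 0], !₂[0, -1, 0], !₂[0, 0, 1], !₂[0, 0, -1]]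

/-- the edge matrix of a field on a sub-tetrahedron of a labelled octahedron in coordinates. -/
theorem edgeMat_comp (Φ : Fin 6 → E3) (s : Fin 4 → Fin 6) :
    edgeMat (Φ ∘ s) = !![Φ (s 1) 0 - Φ (s 0) 0, Φ (s 2) 0 - Φ (s 0) 0, Φ (s 3) 0 - Φ (s 0) 0;
                         Φ (s 1) 1 - Φ (s 0) 1, Φ (s 2) 1 - Φ (s 0) 1, Φ (s 3) 1 - Φ (s 0) 1;
                         Φ (s 1) 2 - Φ (s 0) 2, Φ (s 2) 2 - Φ (s 0) 2, Φ (s 3) 2 - Φ (s 0) 2] := by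
  ext i j; fin_cases i <;> fin_cases j <;> simp [edgeMat]

/-- the twelve-edge sum written out. -/
theorem sum_octPairs (f : Fin 6 × Fin 6 → ℝ) :
    ∑ p ∈ octPairs, f p = f (0, 2) + f (0, 3) + f (0, 4) + f (0, 5) + f (1, 2) + f (1, 3) + f (1, 4) + f (1, 5) +
      f (2, 4) + f (2, 5) + f (3, 4) + f (3, 5) := by
  simp only [octPairs, Finset.sum_filter, Fintype.sum_prod_type, Fin.sum_univ_six]
  simp [Fin.lt_def]
  ring

/-- edge matrix of sub-tetrahedron 0 of the reference octahedron. -/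
theorem edgeMat_refOct_sub0 : edgeMat (refOct ∘ octSub 0) = !![(-2), (-1), (-1); 0, 1, 0; 0, 0, 1] := by
  ext i j; fin_cases i <;> fin_cases j <;>
    simp [edgeMat, refOct, octSub, show (-1 : ℝ) - 1 = -2 by norm_num]

/-- its inverse (rational). -/
theorem edgeMat_refOct_sub0_inv : (edgeMat (refOct ∘ octSub 0))⁻¹ = !![(-(1/2) : ℝ), (-(1/2) : ℝ), (-(1/2) : ℝ); 0, 1, 0; 0, 0, 1] := by
  rw [edgeMat_refOct_sub0]
  apply Matrix.inv_eq_right_inv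
  ext i j; fin_cases i <;> fin_cases j <;>
    norm_num [Matrix.mul_apply, Fin.sum_univ_three, Matrix.cons_val_zero, Matrix.cons_val_one, Matrix.cons_val_two,
      Matrix.head_cons, Matrix.tail_cons]

/-- its volume `1/3`. -/
theorem simplexVol_refOct_sub0 : simplexVol (refOct ∘ octSub 0) = 1/3 := by
  rw [simplexVol, edgeMat_refOct_sub0, Matrix.det_fin_three]
  norm_num [Matrix.cons_val_zero, Matrix.cons_val_one, Matrix.cons_val_two, Matrix.head_cons, Matrix.tail_cons]

/-- edge matrix of sub-tetrahedron 1 of the reference octahedron. -/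
theorem edgeMat_refOct_sub1 : edgeMat (refOct ∘ octSub 1) = !![(-2), (-1), (-1); 0, 0, (-1); 0, 1, 0] := by
  ext i j; fin_cases i <;> fin_cases j <;>
    simp [edgeMat, refOct, octSub, show (-1 : ℝ) - 1 = -2 by norm_num]

/-- its inverse (rational). -/
theorem edgeMat_refOct_sub1_inv : (edgeMat (refOct ∘ octSub 1))⁻¹ = !![(-(1/2) : ℝ), (1/2 : ℝ), (-(1/2) : ℝ); 0, 0, 1; 0, (-1), 0] := by
  rw [edgeMat_refOct_sub1]
  apply Matrix.inv_eq_right_inv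
  ext i j; fin_cases i <;> fin_cases j <;>
    norm_num [Matrix.mul_apply, Fin.sum_univ_three, Matrix.cons_val_zero, Matrix.cons_val_one, Matrix.cons_val_two,
      Matrix.head_cons, Matrix.tail_cons]

/-- its volume `1/3`. -/
theorem simplexVol_refOct_sub1 : simplexVol (refOct ∘ octSub 1) = 1/3 := by
  rw [simplexVol, edgeMat_refOct_sub1, Matrix.det_fin_three]
  norm_num [Matrix.cons_val_zero, Matrix.cons_val_one, Matrix.cons_val_two, Matrix.head_cons, Matrix.tail_cons]

/-- edge matrix of sub-tetrahedron 2 of the reference octahedron. -/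
theorem edgeMat_refOct_sub2 : edgeMat (refOct ∘ octSub 2) = !![(-2), (-1), (-1); 0, (-1), 0; 0, 0, (-1)] := by
  ext i j; fin_cases i <;> fin_cases j <;>
    simp [edgeMat, refOct, octSub, show (-1 : ℝ) - 1 = -2 by norm_num]

/-- its inverse (rational). -/
theorem edgeMat_refOct_sub2_inv : (edgeMat (refOct ∘ octSub 2))⁻¹ = !![(-(1/2) : ℝ), (1/2 : ℝ), (1/2 : ℝ); 0, (-1), 0; 0, 0, (-1)] := by
  rw [edgeMat_refOct_sub2]
  apply Matrix.inv_eq_right_inv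
  ext i j; fin_cases i <;> fin_cases j <;>
    norm_num [Matrix.mul_apply, Fin.sum_univ_three, Matrix.cons_val_zero, Matrix.cons_val_one, Matrix.cons_val_two,
      Matrix.head_cons, Matrix.tail_cons]

/-- its volume `1/3`. -/
theorem simplexVol_refOct_sub2 : simplexVol (refOct ∘ octSub 2) = 1/3 := by
  rw [simplexVol, edgeMat_refOct_sub2, Matrix.det_fin_three]
  norm_num [Matrix.cons_val_zero, Matrix.cons_val_one, Matrix.cons_val_two, Matrix.head_cons, Matrix.tail_cons]

/-- edge matrix of sub-tetrahedron 3 of the reference octahedron. -/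
theorem edgeMat_refOct_sub3 : edgeMat (refOct ∘ octSub 3) = !![(-2), (-1), (-1); 0, 0, 1; 0, (-1), 0] := by
  ext i j; fin_cases i <;> fin_cases j <;>
    simp [edgeMat, refOct, octSub, show (-1 : ℝ) - 1 = -2 by norm_num]

/-- its inverse (rational). -/
theorem edgeMat_refOct_sub3_inv : (edgeMat (refOct ∘ octSub 3))⁻¹ = !![(-(1/2) : ℝ), (-(1/2) : ℝ), (1/2 : ℝ); 0, 0, (-1); 0, 1, 0] := by
  rw [edgeMat_refOct_sub3]
  apply Matrix.inv_eq_right_inv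
  ext i j; fin_cases i <;> fin_cases j <;>
    norm_num [Matrix.mul_apply, Fin.sum_univ_three, Matrix.cons_val_zero, Matrix.cons_val_one, Matrix.cons_val_two,
      Matrix.head_cons, Matrix.tail_cons]

/-- its volume `1/3`. -/
theorem simplexVol_refOct_sub3 : simplexVol (refOct ∘ octSub 3) = 1/3 := by
  rw [simplexVol, edgeMat_refOct_sub3, Matrix.det_fin_three]
  norm_num [Matrix.cons_val_zero, Matrix.cons_val_one, Matrix.cons_val_two, Matrix.head_cons, Matrix.tail_cons]

/-- ★ the REGULAR OCT CERTIFICATE at `c = 8`, `μ = −4` (file convention, diagonal split `(0,1)`), reference cell in the integer fcc frame: an explicit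
ten-square SOS. -/
theorem octCertRef_nonneg (Φ : Fin 6 → E3) :
    0 ≤ (8 * ∑ p ∈ octPairs, pairS refOct Φ p - ∑ p ∈ octPairs, pairN Φ p) / 3 - (-4) * octNL refOct Φ := by
  rw [sum_octPairs, sum_octPairs, octNL, Fin.sum_univ_four]
  simp only [simplexNL, affGrad]
  rw [simplexVol_refOct_sub0, simplexVol_refOct_sub1, simplexVol_refOct_sub2, simplexVol_refOct_sub3, edgeMat_refOct_sub0_inv,
    edgeMat_refOct_sub1_inv, edgeMat_refOct_sub2_inv, edgeMat_refOct_sub3_inv]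
  simp only [edgeMat_comp, Matrix.mul_fin_three, sigmaTwo_fin_three]
  simp only [octSub, Matrix.of_apply, Matrix.cons_val', Matrix.cons_val_zero, Matrix.cons_val_one, Matrix.cons_val_two,
    Matrix.cons_val_three, Matrix.head_cons, Matrix.tail_cons, Matrix.empty_val', Matrix.cons_val_fin_one]
  simp only [pairS_coord, pairN_coord]
  simp [refOct]
  norm_num
  have h : (0 : ℝ) ≤ (1/4 : ℝ) * ((4 : ℝ) * Φ 0 0 + (-1 : ℝ) * Φ 2 0 + (2 : ℝ) * Φ 2 1 + (-1 : ℝ) * Φ 3 0 + (-2 : ℝ) * Φ 3 1 + (-1 : ℝ) * Φ 4 0 +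
      (2 : ℝ) * Φ 4 2 + (-1 : ℝ) * Φ 5 0 + (-2 : ℝ) * Φ 5 2) ^ 2 +
      (1/12 : ℝ) * ((4 : ℝ) * Φ 0 1 + (2 : ℝ) * Φ 2 0 + (-3 : ℝ) * Φ 2 1 + (-2 : ℝ) * Φ 3 0 + (-3 : ℝ) * Φ 3 1 + (1 : ℝ) * Φ 4 1 + (1 : ℝ) * Φ 5 1) ^ 2 +
      (1/12 : ℝ) * ((4 : ℝ) * Φ 0 2 + (1 : ℝ) * Φ 2 2 + (1 : ℝ) * Φ 3 2 + (2 : ℝ) * Φ 4 0 + (-3 : ℝ) * Φ 4 2 + (-2 : ℝ) * Φ 5 0 + (-3 : ℝ) * Φ 5 2) ^ 2 +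
      (1/4 : ℝ) * ((4 : ℝ) * Φ 1 0 + (-1 : ℝ) * Φ 2 0 + (-2 : ℝ) * Φ 2 1 + (-1 : ℝ) * Φ 3 0 + (2 : ℝ) * Φ 3 1 + (-1 : ℝ) * Φ 4 0 + (-2 : ℝ) * Φ 4 2 +
          (-1 : ℝ) * Φ 5 0 + (2 : ℝ) * Φ 5 2) ^ 2 +
      (1/12 : ℝ) * ((4 : ℝ) * Φ 1 1 + (-2 : ℝ) * Φ 2 0 + (-3 : ℝ) * Φ 2 1 + (2 : ℝ) * Φ 3 0 + (-3 : ℝ) * Φ 3 1 + (1 : ℝ) * Φ 4 1 + (1 : ℝ) * Φ 5 1) ^ 2 +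
      (1/12 : ℝ) * ((4 : ℝ) * Φ 1 2 + (1 : ℝ) * Φ 2 2 + (1 : ℝ) * Φ 3 2 + (-2 : ℝ) * Φ 4 0 + (-3 : ℝ) * Φ 4 2 + (2 : ℝ) * Φ 5 0 + (-3 : ℝ) * Φ 5 2) ^ 2 +
      (1/6 : ℝ) * ((1 : ℝ) * Φ 2 0 + (1 : ℝ) * Φ 3 0 + (-1 : ℝ) * Φ 4 0 + (-1 : ℝ) * Φ 5 0) ^ 2 +
      (1/2 : ℝ) * ((1 : ℝ) * Φ 2 1 + (1 : ℝ) * Φ 3 1 + (-1 : ℝ) * Φ 4 1 + (-1 : ℝ) * Φ 5 1) ^ 2 +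
      (1/42 : ℝ) * ((7 : ℝ) * Φ 2 2 + (-1 : ℝ) * Φ 3 2 + (4 : ℝ) * Φ 4 1 + (-3 : ℝ) * Φ 4 2 + (-4 : ℝ) * Φ 5 1 + (-3 : ℝ) * Φ 5 2) ^ 2 +
      (2/7 : ℝ) * ((2 : ℝ) * Φ 3 2 + (-1 : ℝ) * Φ 4 1 + (-1 : ℝ) * Φ 4 2 + (1 : ℝ) * Φ 5 1 + (-1 : ℝ) * Φ 5 2) ^ 2 := by positivity
  exact h.trans_eq (by ring)

/-! ### The certificates of NODE E at reference cells (object level) -/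

/-- ★ (CC♯) at a labelled tetrahedral cell sitting at the reference tetrahedron: `0 ≤ tetCert 8 (−4)` for EVERY field. -/
theorem tetCert_nonneg_of_cellPos (a b : E3) (w : ℤ → E3) (φ : Cell 2 → ℤ → E3) (t : Fin 4 → Cell 2 × ℤ)
    (h : cellPos a b w t = refTet) : 0 ≤ tetCert 8 (-4) a b w φ t := by
  unfold tetCert tetS tetN tetNL
  rw [h]
  exact tetCertRef_nonneg (cellVal φ t)

/-- ★ (CC♯) at a labelled octahedral cell sitting at the reference octahedron: `0 ≤ octCert 8 (−4)` for EVERY field. -/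
theorem octCert_nonneg_of_cellPos (a b : E3) (w : ℤ → E3) (φ : Cell 2 → ℤ → E3) (o : Fin 6 → Cell 2 × ℤ)
    (h : cellPos a b w o = refOct) : 0 ≤ octCert 8 (-4) a b w φ o := by
  unfold octCert octS octN octNLw
  rw [h]
  exact octCertRef_nonneg (cellVal φ o)

/-- record: the certificates are monotone in `c` (larger Korn constant `c` only helps), so the reference cells certify every `c ≥ 8` at `μ = −4`. -/
theorem tetCertRef_nonneg_of_le (Φ : Fin 4 → E3) {c : ℝ} (hc : 8 ≤ c) :
    0 ≤ (c * ∑ p ∈ tetPairs, pairS refTet Φ p - ∑ p ∈ tetPairs, pairN Φ p) / 6 - (-4) * simplexNL refTet Φ := by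
  have h := tetCertRef_nonneg Φ
  have hS : 0 ≤ ∑ p ∈ tetPairs, pairS refTet Φ p := Finset.sum_nonneg fun p _ => by unfold pairS; positivity
  nlinarith [mul_le_mul_of_nonneg_right hc hS]

end Summit.AtomisticToContinuum.Crystallization.Theorems.ChartedZeroExcessLayeredLatticeLiouville
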